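import Literature.AlgebraicGeometry.Motives.ClosedPointsConstantFieldExtension
import Literature.AlgebraicGeometry.Motives.ZetaFunctionProofs
import Mathlib.FieldTheory.Finite.Extension
import HarnessLib

/-!
# The zeta function of the base change `X_K = X ×_k Spec K` along a finite extension of finite fields:
# `#X_K(L) = #X(L)`, `#X_K(𝔽_{(q^m)^s}) = #X(𝔽_{q^{ms}})`, `Z(X_K/𝔽_{q^m}, T) = F_m Z(X/𝔽_q, T)`
# (Ramachandran Thm. 2.1 (iv); Naumann Prop. 8 ii)), and the closed points of `X_K`

Topic `Literature/AlgebraicGeometry/Motives`; THEOREMS ONLY (no definition, no instance, no named fact;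
D-0026).  `X_K` is the tree's `(baseChange k K).obj X` (`Motives/Varieties`: Mathlib `Over.pullback` along
`Spec K → Spec k`), a `K`-scheme with underlying scheme `pullback X.hom (Spec K → Spec k)`.  The tree's
`zetaSeriesPow X m = exp(Σ_s N_{ms}(X) Tˢ/s)` (`Motives/ZetaFunctionConstantFieldExtension`, «the zeta function
of `X ⊗ 𝔽_{q^m}`» by name only) is here IDENTIFIED with the zeta function `zetaSeries ((baseChange k K).obj X)`
of the base-changed `K`-scheme, and the combinatorial closed-point counts of
`Motives/ClosedPointsConstantFieldExtension` (`#{P | deg_m P = t}/t`) with its `closedPointCount`.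

Printed sources, read on the page.

* N. Ramachandran, *Zeta functions, Grothendieck groups, and the Witt ring*, Bull. Sci. Math. 139 (2015)
  [Ramachandran2014] (held arXiv text 1407.1813, p0006): **Thm. 2.1 (iv)** «For any `m ∈ ℕ`, let `X_m` be the
  variety over `𝔽_{q^m}` obtained by base change along `b : 𝔽_q → 𝔽_{q^m}`. One has `Z(X_m/𝔽_{q^m}, t) =
  F_m(Z(X/𝔽_q, t))`», proof: «Write `g_n = #X(𝔽_{q^n})` and `h_n = #X_m(𝔽_{q^{nm}})`. These are the ghost
  components of `Z(X, t)` and `Z(X_m/𝔽_{q^m}, t)` respectively. As `h_n = #X_m(𝔽_{q^{mn}}) = #X(𝔽_{q^{mn}}) =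
  g_{nm}`, the definition of `F_m` … gives (iv)»; §1 «a (Frobenius) ring homomorphism `F_n : W(A) → W(A)`».
* N. Naumann, *Algebraic independence in the Grothendieck ring of varieties*, Trans. AMS 359 (2007)
  [Naumann2007] (held arXiv text math/0403075): §2.1 «a ring homomorphism (base change) `−×_k L : K₀(Var_k) →
  K₀(Var_L)`, `[X] ↦ [X ×_k L]`»; §2.3 Prop. 8 ii): the commutative square `μ_{q^ν} ∘ (− ×_{𝔽_q} 𝔽_{q^ν}) =
  F_ν ∘ μ_q`.
* R. Hartshorne, *Algebraic Geometry* [Hartshorne1977], II.3 Thm. 3.3 and II Ex. 2.7 (points of the fibre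
  product with values in a field; the tree's `AlgPoints.baseChangeEquiv` for `L = K`).
* H. Niederreiter, C. Xing [NiederreiterXing2009], §2.1 Prop. 2.1.3; H. Stichtenoth [Stichtenoth2009],
  Lemma 5.1.9 (d), Theorem 5.1.15 (f) (the constant field extension).

## Contents (theorems only)

* §1 (any fields `k ⊆ K ⊆ L`) `overMap_obj_specOver` (`(Spec L → Spec K)_{/k} = (Spec L → Spec k)`),
  **`natCard_algPoints_baseChange`** (`#X_K(L) = #X(L)`: the universal property of the fibre product,
  Mathlib `Over.mapPullbackAdj`), `locallyOfFiniteType_baseChange_hom`, `quasiCompact_baseChange_hom`.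
* §2 (`k = 𝔽_q ⊆ K = 𝔽_{q^m}` finite, ANY `k`-scheme `X`) `pointCountOver_baseChange`,
  **`pointCount_baseChange`** (`#X_K(𝔽_{(q^m)^s}) = #X(𝔽_{q^{ms}})` — Ramachandran's «`h_n = g_{nm}`»),
  **`logZetaSeries_baseChange`**, **`zetaSeries_baseChange`** (**Thm. 2.1 (iv): `Z(X_K, T) = zetaSeriesPow X m
  = F_m Z(X, T)`**), `zetaSeries_baseChange_self` (`K = k`).
* §3 (`X` of finite type) **`mul_closedPointCount_baseChange`** (`t · a_t(X_K) = #{P ∈ X(k̄) | deg_m P = t}`,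
  `deg_m P` the least period of `P` under `φᵐ`), **`closedPointCount_baseChange_eq_sum`** (Niederreiter–Xing
  Prop. 2.1.3 / Stichtenoth Lemma 5.1.9 (d) for the base-changed scheme: `a_t(X_K) = Σ_{d ∣ mt, d/gcd(d,m) = t}
  gcd(d, m) · a_d(X)`), `trunc_zetaSeries_baseChange_mul_prod_eq_one` (its Euler product).

## References

* [Ramachandran2014] N. Ramachandran, Bull. Sci. Math. 139 (2015) 599–627 (arXiv:1407.1813), §1, Thm. 2.1 (iv)
  with proof.
* [Naumann2007] N. Naumann, Trans. Amer. Math. Soc. 359 (2007) 1653–1683, §2.1, §2.3 Prop. 8 ii).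
* [Hartshorne1977] R. Hartshorne, GTM 52 (1977), II.3 Thm. 3.3, II Ex. 2.7.
* [NiederreiterXing2009] H. Niederreiter, C. Xing (2009), §2.1 Prop. 2.1.3.
* [Stichtenoth2009] H. Stichtenoth, GTM 254 (2009), Lemma 5.1.9 (d), Theorem 5.1.15 (f), (5.7)/(5.9).

## Provenance

Lane `lit-hodgefound` (summit `HodgeConjecture`, Track 2 foundations library, Layer B: motives / zeta
functions), seat `lit-hodgefound-p29` (literature-prover, generation 47, row g47-#11).
-/

universe u

open CategoryTheory AlgebraicGeometry Limits Function PowerSeries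

noncomputable section

namespace Literature.AlgebraicGeometry.Motives

/-! ### §1 `L`-points of `X_K` are `L`-points of `X` -/

section AnyField

variable (k K L : Type u) [Field k] [Field K] [Field L] [Algebra k K] [Algebra K L] [Algebra k L]
  [IsScalarTower k K L]

/-- `(Spec L → Spec K)_{/k} = (Spec L → Spec k)`: restricting the scalars of the `K`-scheme `Spec L` along
`k ⊆ K` gives the `k`-scheme `Spec L` (transitivity of structure maps in the tower `k ⊆ K ⊆ L`).
[cite: Hartshorne1977, II Ex. 2.7] -/
theorem overMap_obj_specOver :
    (Over.map (Spec.map (CommRingCat.ofHom (algebraMap k K)))).obj (specOver K L) = specOver k L := by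
  change Over.mk (Spec.map (CommRingCat.ofHom (algebraMap K L)) ≫
    Spec.map (CommRingCat.ofHom (algebraMap k K))) = specOver k L
  rw [← Spec.map_comp, ← CommRingCat.ofHom_comp, ← IsScalarTower.algebraMap_eq]

variable {k K} (X : SchemeOver k)

/-- **`#X_K(L) = #X(L)`** for every field `L ⊇ K ⊇ k`: the `L`-points of `X_K` over `K` are the `L`-points of
`X` over `k`, by the universal property of the fibre product `X_K = X ×_k Spec K` (Mathlib's adjunction
`Over.map ⊣ Over.pullback`, `Over.mapPullbackAdj`, at the object `Spec L → Spec K`, whose restriction of scalars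
is `Spec L → Spec k`; the tree's `AlgPoints.baseChangeEquiv` is the case `L = K`) — Ramachandran, proof of
Thm. 2.1 (iv): «`#X_m(𝔽_{q^{mn}}) = #X(𝔽_{q^{mn}})`»; no finiteness hypothesis (both sides are `0` together
when infinite). [cite: Ramachandran2014, Thm. 2.1 (iv) (proof)] [cite: Hartshorne1977, II.3 Thm. 3.3 and II Ex. 2.7] -/
theorem natCard_algPoints_baseChange :
    Nat.card (AlgPoints ((baseChange k K).obj X) L) = Nat.card (AlgPoints X L) := by
  refine Nat.card_congr
    ((((Over.mapPullbackAdj (Spec.map (CommRingCat.ofHom (algebraMap k K)))).homEquiv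
      (specOver K L) X).symm).trans ?_)
  exact Iso.homCongr (eqToIso (overMap_obj_specOver k K L)) (Iso.refl X)

/-- `X_K → Spec K` is locally of finite type if `X → Spec k` is (base change).
[cite: Naumann2007, §2.1 (base change)] -/
theorem locallyOfFiniteType_baseChange_hom [LocallyOfFiniteType X.hom] :
    LocallyOfFiniteType ((baseChange k K).obj X).hom :=
  MorphismProperty.pullback_snd _ _ inferInstance

/-- `X_K → Spec K` is quasi-compact if `X → Spec k` is (base change). [cite: Naumann2007, §2.1 (base change)] -/
theorem quasiCompact_baseChange_hom [QuasiCompact X.hom] : QuasiCompact ((baseChange k K).obj X).hom :=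
  MorphismProperty.pullback_snd _ _ inferInstance

end AnyField

/-! ### §2 Finite fields: `#X_K(𝔽_{(q^m)^s}) = #X(𝔽_{q^{ms}})` and `Z(X_K, T) = F_m Z(X, T)` -/

section FiniteField

variable {k : Type u} [Field k] [Finite k] (K : Type u) [Field K] [Algebra k K] [Finite K] (X : SchemeOver k)

omit [Finite k] [Finite K] in
/-- `#X_K(L) = #X(L)` as naive point counts over a field `L ⊇ K ⊇ k`.
[cite: Ramachandran2014, Thm. 2.1 (iv) (proof)] -/
theorem pointCountOver_baseChange (L : Type u) [Field L] [Algebra K L] [Algebra k L] [IsScalarTower k K L] :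
    pointCountOver ((baseChange k K).obj X) L = pointCountOver X L :=
  natCard_algPoints_baseChange L X

omit [Finite k] in
/-- A finite field `K` has, inside `K̄`, an extension of every degree `s ≥ 1`: an intermediate field `L` of
`K̄/K` with `#L = #K^s` (Mathlib's `FiniteField.Extension K p s`, embedded in `K̄`; private helper). [folklore] -/
private theorem exists_intermediateField_natCard_eq {s : ℕ} (hs : 0 < s) :
    ∃ L : IntermediateField K (AlgebraicClosure K), Nat.card L = Nat.card K ^ s := by
  haveI : Fact (ringChar K).Prime := ⟨CharP.char_is_prime K (ringChar K)⟩
  haveI : NeZero s := ⟨hs.ne'⟩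
  let E := FiniteField.Extension K (ringChar K) s
  let ι : E →ₐ[K] AlgebraicClosure K := IsAlgClosed.lift
  refine ⟨ι.fieldRange, ?_⟩
  rw [← FiniteField.natCard_extension K (ringChar K) s]
  have e : Set.range ι ≃ ι.fieldRange :=
    Equiv.subtypeEquivRight fun y => (AlgHom.mem_fieldRange.trans Set.mem_range.symm).symm
  have hι : Function.Injective ι := ι.toRingHom.injective
  rw [← Nat.card_congr e, Nat.card_range_of_injective hι]

/-- **Ramachandran Thm. 2.1 (iv), ghost components: `#X_K(𝔽_{(q^m)^s}) = #X(𝔽_{q^{ms}})`** (`m = [K : k]`,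
`s ≥ 1`, ANY `k`-scheme `X`): in the tree's intrinsic counts, `pointCount ((baseChange k K).obj X) s =
pointCount X (m·s)` — both are `#X_K(L) = #X(L)` for an extension `L/K` of degree `s` (`[L : k] = ms`;
`pointCount_eq_pointCountOver_holds` on both sides). «As `h_n = #X_m(𝔽_{q^{mn}}) = #X(𝔽_{q^{mn}}) = g_{nm}` …».
[cite: Ramachandran2014, Thm. 2.1 (iv) (proof)] [cite: Naumann2007, §2.3 Prop. 8 ii)] -/
theorem pointCount_baseChange {s : ℕ} (hs : 0 < s) :
    pointCount ((baseChange k K).obj X) s = pointCount X (Module.finrank k K * s) := by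
  haveI : Module.Finite k K := Module.Finite.of_finite
  obtain ⟨L, hL⟩ := exists_intermediateField_natCard_eq K hs
  haveI : Finite L := by
    have hpos : 0 < Nat.card L := by
      rw [hL]
      exact pow_pos Nat.card_pos s
    exact Nat.finite_of_card_ne_zero hpos.ne'
  haveI : Module.Finite K L := Module.Finite.of_finite
  haveI : Module.Finite k L := Module.Finite.of_finite
  have h2k : 2 ≤ Nat.card k := Finite.one_lt_card
  have h2K : 2 ≤ Nat.card K := Finite.one_lt_card
  have hKL : Module.finrank K L = s := by
    apply Nat.pow_right_injective h2K
    simp only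
    rw [← Module.natCard_eq_pow_finrank, hL]
  have hkL : Module.finrank k L = Module.finrank k K * s := by
    apply Nat.pow_right_injective h2k
    simp only
    rw [← Module.natCard_eq_pow_finrank, hL, pow_mul, ← Module.natCard_eq_pow_finrank]
  rw [pointCount_eq_pointCountOver_holds (X := (baseChange k K).obj X) L hKL hs,
    pointCount_eq_pointCountOver_holds (X := X) L hkL (Nat.mul_pos Module.finrank_pos hs),
    pointCountOver_baseChange]

/-- `#X_K(𝔽_{q^m}) = #X(𝔽_{q^m})`: the `K`-rational points of `X_K` are the `K`-points of `X`.
[cite: Ramachandran2014, Thm. 2.1 (iv) (proof)] -/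
theorem pointCount_baseChange_one : pointCount ((baseChange k K).obj X) 1 = pointCount X (Module.finrank k K) := by
  rw [pointCount_baseChange K X one_pos, mul_one]

/-- **`log Z(X_K, T) = Σ_s N_{ms}(X) Tˢ/s = logZetaSeriesPow X m`**, `m = [K : k]`.
[cite: Ramachandran2014, Thm. 2.1 (iv)] -/
theorem logZetaSeries_baseChange :
    logZetaSeries ((baseChange k K).obj X) = logZetaSeriesPow X (Module.finrank k K) := by
  ext s
  rw [coeff_logZetaSeries, coeff_logZetaSeriesPow]
  rcases Nat.eq_zero_or_pos s with rfl | hs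
  · simp
  · rw [if_neg hs.ne', if_neg hs.ne', pointCount_baseChange K X hs]

/-- **Ramachandran Thm. 2.1 (iv) / Naumann Prop. 8 ii): `Z(X_K/𝔽_{q^m}, T) = F_m Z(X/𝔽_q, T)`** — the zeta
function of the base-changed `K`-scheme `X_K = X ×_{𝔽_q} Spec 𝔽_{q^m}` IS the tree's `zetaSeriesPow X m =
exp(Σ_s #X(𝔽_{q^{ms}}) Tˢ/s)` («the zeta function of the constant field extension», Stichtenoth Thm. 5.1.15 (f)),
for every `k`-scheme `X`. [cite: Ramachandran2014, Thm. 2.1 (iv)] [cite: Naumann2007, §2.3 Prop. 8 ii)] [cite: Stichtenoth2009, Theorem 5.1.15 (f)] -/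
theorem zetaSeries_baseChange :
    zetaSeries ((baseChange k K).obj X) = zetaSeriesPow X (Module.finrank k K) := by
  rw [zetaSeries, zetaSeriesPow, logZetaSeries_baseChange]

omit [Finite K] in
/-- `Z(X_k, T) = Z(X, T)` for the trivial base change `K = k` (`zetaSeriesPow X 1 = zetaSeries X`).
[cite: Ramachandran2014, Thm. 2.1 (iv)] -/
theorem zetaSeries_baseChange_self : zetaSeries ((baseChange k k).obj X) = zetaSeries X := by
  rw [zetaSeries_baseChange, Module.finrank_self, zetaSeriesPow_one]

/-! ### §3 Closed points of `X_K`: `t · a_t(X_K) = #{P ∈ X(k̄) | deg_m P = t}` -/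

variable [LocallyOfFiniteType X.hom] [QuasiCompact X.hom]

/-- **`t · a_t(X_K) = #{P ∈ X(k̄) | deg_m P = t}`** (`t ≥ 1`, `m = [K : k]`, `X` of finite type, `deg_m P =
minimalPeriod (φᵐ) P` the degree over `𝔽_{q^m}`): the closed points of degree `t` of the base-changed scheme
`X_K` are counted by the `φᵐ`-orbits of length `t` on `X(k̄)` — both sides are the Möbius transform
`Σ_{e ∣ t} μ(t/e) N_e` of the same point counts `N_e(X_K) = N_{me}(X) = #Fix(φ^{me})` (the tree's
`sum_moebius_mul_pointCount_eq_mul_closedPointCount` and `Dynamics.FixedPoints.sum_moebius_mul_natCard_fixedPoints_iterate_eq`).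
This identifies the combinatorial model of `Motives/ClosedPointsConstantFieldExtension` with `X_K`.
[cite: NiederreiterXing2009, §2.1 Prop. 2.1.3 (proof)] [cite: Stichtenoth2009, Lemma 5.1.9 (d) and (5.41)] -/
theorem mul_closedPointCount_baseChange {t : ℕ} (ht : 0 < t) :
    (t : ℤ) * closedPointCount ((baseChange k K).obj X) t =
      Nat.card {P : AlgPoints X (AlgebraicClosure k) |
        minimalPeriod (AlgPoints.frobMap X)^[Module.finrank k K] P = t} := by
  haveI := locallyOfFiniteType_baseChange_hom (K := K) X
  haveI := quasiCompact_baseChange_hom (K := K) X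
  haveI : Module.Finite k K := Module.Finite.of_finite
  have hm : 0 < Module.finrank k K := Module.finrank_pos
  rw [← sum_moebius_mul_pointCount_eq_mul_closedPointCount _ ht,
    ← Literature.Dynamics.FixedPoints.sum_moebius_mul_natCard_fixedPoints_iterate_eq _ ht]
  · refine Finset.sum_congr rfl fun e he => ?_
    rw [pointCount_baseChange K X (Nat.pos_of_mem_divisors he), pointCount_eq_natCard_fixedPoints,
      iterate_mul]
  · rw [← iterate_mul]
    exact finite_fixedPoints_iterate X (Nat.mul_pos hm ht)

/-- `a_t(X_K) = #{P ∈ X(k̄) | deg_m P = t} / t` (`t ≥ 1`): the number of closed points of degree `t` of `X_K`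
in the combinatorial form of `Motives/ClosedPointsConstantFieldExtension`.
[cite: NiederreiterXing2009, §2.1 Prop. 2.1.3 (proof)] [cite: Stichtenoth2009, Lemma 5.1.9 (d)] -/
theorem closedPointCount_baseChange {t : ℕ} (ht : 0 < t) :
    closedPointCount ((baseChange k K).obj X) t =
      Nat.card {P : AlgPoints X (AlgebraicClosure k) |
        minimalPeriod (AlgPoints.frobMap X)^[Module.finrank k K] P = t} / t := by
  have h := mul_closedPointCount_baseChange K X ht
  have h' : t * closedPointCount ((baseChange k K).obj X) t =
      Nat.card {P : AlgPoints X (AlgebraicClosure k) |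
        minimalPeriod (AlgPoints.frobMap X)^[Module.finrank k K] P = t} := by
    exact_mod_cast h
  rw [← h', Nat.mul_div_cancel_left _ ht]

/-- **Niederreiter–Xing Prop. 2.1.3 / Stichtenoth Lemma 5.1.9 (d) for the base-changed scheme: `a_t(X_K) =
Σ_{d ∣ mt, d/gcd(d, m) = t} gcd(d, m) · a_d(X)`** (`m = [K : k]`, `t ≥ 1`, `X` of finite type) — «an
`𝔽_q`-closed point `P` of degree `m` [here `d`] splits into `gcd(r, m)` `𝔽_{q^r}`-closed points of degree
`m/gcd(r, m)`» [here `r = [K : k]`], counted over all closed points of `X` (the tree's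
`natCard_minimalPeriod_frobMap_iterate_div_eq_sum` ∧ `closedPointCount_baseChange`).
[cite: NiederreiterXing2009, §2.1 Prop. 2.1.3] [cite: Stichtenoth2009, Lemma 5.1.9 (d)] -/
theorem closedPointCount_baseChange_eq_sum {t : ℕ} (ht : 0 < t) :
    closedPointCount ((baseChange k K).obj X) t =
      ∑ d ∈ (Module.finrank k K * t).divisors with d / Nat.gcd d (Module.finrank k K) = t,
        Nat.gcd d (Module.finrank k K) * closedPointCount X d := by
  haveI : Module.Finite k K := Module.Finite.of_finite
  rw [closedPointCount_baseChange K X ht,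
    natCard_minimalPeriod_frobMap_iterate_div_eq_sum X Module.finrank_pos ht]

/-- **The Euler product of `Z(X_K, T)` over the closed points of `X_K`, in terms of `X`**: `Z(X_K, T) ·
∏_{t ≤ n} (1 − Tᵗ)^{#{deg_m = t}/t} ≡ 1 (mod T^{n+1})` (the tree's `trunc_zetaSeriesPow_mul_prod_eq_one`, now for
the zeta function of the base-changed scheme; Stichtenoth (5.7)/(5.9) for `F_r`).
[cite: Stichtenoth2009, (5.7), (5.9) and Lemma 5.1.9 (d)] -/
theorem trunc_zetaSeries_baseChange_mul_prod_eq_one (n : ℕ) :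
    trunc (n + 1) (zetaSeries ((baseChange k K).obj X) *
      ∏ t ∈ Finset.Icc 1 n, ((1 : PowerSeries ℚ) - PowerSeries.X ^ t) ^
        (Nat.card {P : AlgPoints X (AlgebraicClosure k) |
          minimalPeriod (AlgPoints.frobMap X)^[Module.finrank k K] P = t} / t)) = 1 := by
  haveI : Module.Finite k K := Module.Finite.of_finite
  rw [zetaSeries_baseChange]
  exact trunc_zetaSeriesPow_mul_prod_eq_one X Module.finrank_pos n

end FiniteField

end Literature.AlgebraicGeometry.Motives

end
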